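import Summits.QuantumFields.YangMills.Theorems.ConvexGribovBodyNonSimplyConnectedLatticeGapDefs
import Summits.QuantumFields.YangMills.Theorems.OneCertifiedCubeFiniteSizeCriterion
import Literature.MathematicalPhysics.QuantumLattice.LatticeGaugeDLRFreeEnergyProofs
import HarnessLib

/-!
# Crux `NonSimplyConnectedLatticeGap` (stmt-QuantumFields-16405), line `Sketch`:
# stub (BRIDGE) `stub_chainChessboard_of_largeFieldSparse` — large-field sparseness on the torus ⇒ CHESS

Pure bookkeeping. Large-field sparseness on the odd tori `(ℤ/(2S+1))⁴`, `S ≥ 1`, says: for every `ε₀ > 0`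
there are `c > 0` and `b₀` with `μ_{β,2S+1} {U | ∀ p ∈ X, ε₀ ≤ N − Re tr ρ(U_p)} ≤ exp (−c β |X|)` for all
`β ≥ b₀` and every finite set `X` of torus plaquettes. CHESS asks, for `a > 0`, `q > 0` and `β ≥ β₃(a, q)`, that
an injective chain `c₀, …, c_k` of plaquettes of `ℤ⁴` with base points in the window `‖x‖∞ + 1 ≤ S` be entirely
`a`-bad on the periodic lift `torusLift (2S+1) V` with `μ_{β,2S+1}`-probability `≤ q^{k+1}`.

* the window has width `2S − 2 < 2S + 1`, so the base points reduce injectively mod `2S + 1`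
  (`FiniteSizeCriterion.injOn_torusProj_of_width`) and the torus image `X` of the chain has `|X| = k + 1`;
* `IsBadPlaquette ρ a (torusLift (2S+1) V) p` is the torus event `Re tr ρ(V_{p̄}) ≤ N − a` at the reduced plaquette `p̄`
  (`plaquetteHolonomyZd_torusLift`), so the chain event is contained in the sparseness event of `X` with `ε₀ = a`;
* with `β₃ = max b₀ (−log q / c)`: `exp (−c β (k+1)) = (exp (−c β))^{k+1} ≤ q^{k+1}`.
-/

set_option autoImplicit false

namespace Summit.QuantumFields.YangMills.Theorems.NonSimplyConnectedLatticeGap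

open MeasureTheory
open Literature.Probability.LatticeModels
open Literature.MathematicalPhysics.QuantumLattice
open Literature.MathematicalPhysics.QuantumFieldTheory (wilsonMeasure GaugeConfig LatticeRep Plaquette plaquetteHolonomy)
open Summit.QuantumFields.YangMills.Cruxes.NonSimplyConnectedLatticeGap.Sketch

/-- Every coordinate of a site is bounded in absolute value by its sup-norm `siteSupNorm`. -/
theorem chainChessboard_natAbs_le_siteSupNorm (x : Site 4) (i : Fin 4) : (x i).natAbs ≤ siteSupNorm x :=
  Finset.le_sup (f := fun j => (x j).natAbs) (Finset.mem_univ i)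

/-- A site in the window `‖x‖∞ + 1 ≤ S` has all coordinates in `[-(S-1), S-1]` (written in `ℤ` without subtraction
of naturals: `-S + 1 ≤ x i ≤ S - 1`). -/
theorem chainChessboard_window_coord_bounds {x : Site 4} {S : ℕ} (h : siteSupNorm x + 1 ≤ S) (i : Fin 4) :
    -(S : ℤ) + 1 ≤ x i ∧ x i ≤ (S : ℤ) - 1 := by
  have h1 : ((x i).natAbs : ℤ) + 1 ≤ S := by
    have := chainChessboard_natAbs_le_siteSupNorm x i
    omega
  have h2 := Int.natAbs_le_self_sq (x i)
  rcases Int.natAbs_eq (x i) with h3 | h3 <;> constructor <;> omega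

/-- On the window `‖x‖∞ + 1 ≤ S` the reduction mod `2S + 1` of base points is injective. -/
theorem chainChessboard_torusProj_injective {S k : ℕ} {c : Fin (k + 1) → ZdPlaquette 4}
    (hinj : Function.Injective c) (hwin : ∀ i, siteSupNorm (c i).1 + 1 ≤ S) :
    Function.Injective fun i => ((Torus.proj (2 * S + 1) (c i).1, (c i).2) : Plaquette 4 (2 * S + 1)) := by
  intro i j hij
  simp only [Prod.mk.injEq] at hij
  apply hinj
  refine Prod.ext ?_ hij.2
  exact FiniteSizeCriterion.injOn_torusProj_of_width (M := 2 * S + 1) (lo := -(S : ℤ) + 1) (hi := (S : ℤ) - 1)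
    (by push_cast; linarith) (fun l => chainChessboard_window_coord_bounds (hwin i) l)
    (fun l => chainChessboard_window_coord_bounds (hwin j) l) hij.1

/-- **Stub BRIDGE — large-field sparseness on the torus ⇒ CHESS.** At large `β` the torus-Wilson probability that a
fixed injective chain `c` of `k+1` plaquettes of `ℤ⁴` with base points in the window `‖x‖∞ + 1 ≤ S` is entirely `a`-bad
on the periodic lift `torusLift (2S+1) V` is at most `q^{k+1}`, granted large-field sparseness on the odd tori
(threshold `β₃ = max b₀ (−log q / c)`; `S = 0` is vacuous). -/
theorem stub_chainChessboard_of_largeFieldSparse : (∀ (G : Type) [Group G] [TopologicalSpace G] [IsTopologicalGroup G] [CompactSpace G] [MeasurableSpace G] [BorelSpace G] (r : Literature.MathematicalPhysics.QuantumFieldTheory.LatticeRep G) (ε₀ : ℝ), 0 < ε₀ → ∃ (c b₀ : ℝ), 0 < c ∧ ∀ β : ℝ, b₀ ≤ β → ∀ S : ℕ, 1 ≤ S → ∀ X : Finset (Literature.MathematicalPhysics.QuantumFieldTheory.Plaquette 4 (2 * S + 1)), (Literature.MathematicalPhysics.QuantumFieldTheory.wilsonMeasure r.ρ β : MeasureTheory.Measure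 (Literature.MathematicalPhysics.QuantumFieldTheory.GaugeConfig 4 (2 * S + 1) G)) {U | ∀ p ∈ X, ε₀ ≤ (r.N : ℝ) - (r.ρ (Literature.MathematicalPhysics.QuantumFieldTheory.plaquetteHolonomy U p.1 p.2.1.1 p.2.1.2)).trace.re} ≤ ENNReal.ofReal (Real.exp (-(c * β * X.card)))) → ∀ (G : Type) [Group G] [TopologicalSpace G] [IsTopologicalGroup G] [CompactSpace G] [MeasurableSpace G] [BorelSpace G], Literature.MathematicalPhysics.QuantumFieldTheory.IsCompactSimpleLieGroup G → ∀ r : Literature.MathematicalPhysics.QuantumFieldTheory.LatticeRep G, ∀ a : ℝ, 0 < a → ∀ q : ℝ, 0 < q → ∃ β₃ : ℝ, ∀ β : ℝ, β₃ ≤ β → ∀ (S k : ℕ) (c : Fin (k + 1) → Literature.MathematicalPhysics.QuantumLattice.ZdPlaquette 4), Function.Injective c → (∀ i, Summit.QuantumFields.YangMills.Cruxes.NonSimplyConnectedLatticeGap.Sketch.siteSupNorm (c i).1 + 1 ≤ S) → ((Literature.MathematicalPhysics.QuantumFieldTheory.wilsonMeasure r.ρ β : MeasureTheory.Measure (Literature.MathematicalPhysics.QuantumFieldTheory.GaugeConfig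 4 (2 * S + 1) G)) {V | ∀ i, Summit.QuantumFields.YangMills.Cruxes.NonSimplyConnectedLatticeGap.Sketch.IsBadPlaquette r.ρ a (Literature.MathematicalPhysics.QuantumLattice.torusLift (2 * S + 1) V) (c i)}).toReal ≤ q ^ (k + 1) := by
  intro hLFS G _ _ _ _ _ _ _ r a ha q hq
  obtain ⟨c₀, b₀, hc₀, H⟩ := hLFS G r a ha
  refine ⟨max b₀ (-Real.log q / c₀), fun β hβ S k ch hinj hwin => ?_⟩
  have hb₀ : b₀ ≤ β := le_trans (le_max_left _ _) hβ
  have hβq : -Real.log q / c₀ ≤ β := le_trans (le_max_right _ _) hβ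
  -- (1) `1 ≤ S` from the window condition at the first plaquette
  have hS : 1 ≤ S := le_trans (Nat.le_add_left 1 _) (hwin 0)
  -- (2) the torus image of the chain has `k + 1` elements
  classical
  set X : Finset (Plaquette 4 (2 * S + 1)) :=
    Finset.univ.image fun i => ((Torus.proj (2 * S + 1) (ch i).1, (ch i).2) : Plaquette 4 (2 * S + 1)) with hX
  have hcard : X.card = k + 1 := by
    rw [hX, Finset.card_image_of_injective _ (chainChessboard_torusProj_injective hinj hwin), Finset.card_univ,
      Fintype.card_fin]
  -- (3) the chain event is contained in the sparseness event of `X`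
  have hsub : {V : GaugeConfig 4 (2 * S + 1) G | ∀ i, IsBadPlaquette r.ρ a (torusLift (2 * S + 1) V) (ch i)} ⊆
      {U | ∀ p ∈ X, a ≤ (r.N : ℝ) - (r.ρ (plaquetteHolonomy U p.1 p.2.1.1 p.2.1.2)).trace.re} := by
    intro V hV p hp
    obtain ⟨i, -, rfl⟩ := Finset.mem_image.1 hp
    have h := hV i
    simp only [IsBadPlaquette, plaquetteObs, FreeEnergy.plaquetteHolonomyZd_torusLift] at h
    linarith
  -- (4) the sparseness bound, passed to `toReal`
  have hμ := (measure_mono hsub).trans (H β hb₀ S hS X)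
  rw [hcard] at hμ
  have hexpq : Real.exp (-(c₀ * β)) ≤ q := by
    rw [← Real.exp_log hq]
    refine Real.exp_le_exp.2 ?_
    rw [div_le_iff₀ hc₀] at hβq
    linarith
  calc ((wilsonMeasure r.ρ β : Measure (GaugeConfig 4 (2 * S + 1) G))
          {V | ∀ i, IsBadPlaquette r.ρ a (torusLift (2 * S + 1) V) (ch i)}).toReal
      ≤ (ENNReal.ofReal (Real.exp (-(c₀ * β * ((k + 1 : ℕ) : ℝ))))).toReal :=
        ENNReal.toReal_mono ENNReal.ofReal_ne_top hμ
    _ = Real.exp (-(c₀ * β)) ^ (k + 1) := by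
        rw [ENNReal.toReal_ofReal (Real.exp_pos _).le, ← Real.exp_nat_mul]
        congr 1
        ring
    _ ≤ q ^ (k + 1) := pow_le_pow_left₀ (Real.exp_pos _).le hexpq (k + 1)

end Summit.QuantumFields.YangMills.Theorems.NonSimplyConnectedLatticeGap
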